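import Summits.HubbardSuperconductivity.HubbardSuperconductivity.Theorems.AnisotropyChordTransferFibre3PhiHatClosed
import Summits.HubbardSuperconductivity.HubbardSuperconductivity.Theorems.AnisotropyChordTransferFibre3MuClosed
import Summits.HubbardSuperconductivity.HubbardSuperconductivity.Theorems.AnisotropyChordTransferFibre3OuterMajorants
import Summits.HubbardSuperconductivity.HubbardSuperconductivity.Theorems.AnisotropyChordTransferFibre3GroundSup
import Summits.HubbardSuperconductivity.HubbardSuperconductivity.Theorems.AnisotropyChordTransferFibre3Regions

/-!
# Route `AnisotropyChord` / H0 rotor rung: PartN41-B §6 — the `⟨Π⁰,C0⟩` OUTER MAJORANT (content version, repaired slope `κ̂′`)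

Theory-1 g22's PartN41-B §6 `PC0OuterBound` (ported …Fibre3N1Row), with the repaired tail slope
`κ̂′ = kapHat + 2·aPar·cS/V` (see …OuterMajorants): for `k` off the single block, writing `φ̂_e = μ_e + ρ_e`
(`‖ρ_e‖ ≤ ½‖1−z_e‖κ̂′g + ½τ̄`, `PhiHatNearClosed` + `tail_slope_abs`), `F₂ = c + t`, `M = Σ_e|μ_e|²` (`MKIdentity`):
`Σ_e |φ̂_e|² F₂ − M c = (Σ_e (|φ̂_e|² − |μ_e|²))(c + t) + M t`, and with `|μ_e| ≤ ‖1−z_e‖β + q`, `Σ_e ‖1−z_e‖² = 2E`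
(`PhaseDefectSum`), Young (`m₀ > 0` free): ★ `pc0_term_bound` (per momentum) and ★ `pc0_outer_bound`:
`|Σ_{outer1} (Σ_e |φ̂_e|²F₂ − M c)| ≤ Σ_{outer1} [M κ̂′ g + (Y + P₂)(|c| + κ̂′g)]`,
`Y = 2βκ̂′gE + τ̄(β²E/m₀ + 2m₀) + 8qκ̂′g + 4qτ̄`, `P₂ = Eκ̂′²g² + 2τ̄²` — exactly `PC0OuterBound` with `κ̂′` for `κ̂`.
Prover seat `hubbard-h0-rotor-p1` g26 (route lead); helper for stmt-HubbardSuperconductivity-23918 (`--supports`, helper class).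
WHAT THIS IS NOT: nothing here proves superconductivity in the Hubbard model; a termwise majorant of ONE row of ONE conditional
reduction.  Tree imports only; no new definitions; no sorry, no axioms.
-/

set_option linter.dupNamespace false
set_option autoImplicit false

noncomputable section

open scoped BigOperators

namespace Summit.HubbardSuperconductivity.HubbardSuperconductivity.Theorems.AnisotropyChord.Transfer.Fibre3

variable (L : ℕ) [NeZero L]

namespace OuterMaj

/-! ## Elementary inequalities -/

omit [NeZero L] in
/-- the per-direction polynomial bound: with `P = uK/2 + τ/2`, `0 ≤ u ≤ 2`, `τ, q, K, β ≥ 0`, `m > 0`,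
`2(uβ + q)P + P² ≤ u²(βK + β²τ/(2m) + K²/2) + (mτ/2 + 2qK + qτ + τ²/2)`. [folklore] -/
theorem dir_poly_bound {u β q K τ m : ℝ} (hu2 : u ≤ 2) (hq : 0 ≤ q) (hK : 0 ≤ K)
    (hτ : 0 ≤ τ) (hm : 0 < m) :
    2 * (u * β + q) * (u * K / 2 + τ / 2) + (u * K / 2 + τ / 2) ^ 2
      ≤ u ^ 2 * (β * K + β ^ 2 * τ / (2 * m) + K ^ 2 / 2) + (m * τ / 2 + 2 * q * K + q * τ + τ ^ 2 / 2) := by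
  have e : u ^ 2 * (β * K + β ^ 2 * τ / (2 * m) + K ^ 2 / 2) + (m * τ / 2 + 2 * q * K + q * τ + τ ^ 2 / 2)
      - (2 * (u * β + q) * (u * K / 2 + τ / 2) + (u * K / 2 + τ / 2) ^ 2)
      = τ * (u * β - m) ^ 2 / (2 * m) + q * K * (2 - u) + (u * K - τ) ^ 2 / 4 := by
    field_simp
    ring
  have h1 : 0 ≤ τ * (u * β - m) ^ 2 / (2 * m) := by positivity
  have h2 : 0 ≤ q * K * (2 - u) := mul_nonneg (mul_nonneg hq hK) (by linarith)
  have h3 : 0 ≤ (u * K - τ) ^ 2 / 4 := by positivity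
  linarith

/-- `‖z̄‖ = 1` for a phase, hence `‖1 + e^{−ik·e}‖ ≤ 2`. [folklore] -/
theorem norm_one_add_zPh_le (k e : Tor L) : ‖(1 : ℂ) + zPh L k e‖ ≤ 2 := by
  have hz : ‖zPh L k e‖ = 1 := by
    unfold zPh
    rw [Complex.norm_conj]
    have h := normSq_phase L k e
    rw [Complex.normSq_eq_norm_sq] at h
    nlinarith [norm_nonneg (phase L k e)]
  calc ‖(1 : ℂ) + zPh L k e‖ ≤ ‖(1 : ℂ)‖ + ‖zPh L k e‖ := norm_add_le _ _
    _ = 2 := by rw [hz, norm_one]; norm_num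

/-- `‖1 − e^{−ik·e}‖ ≤ 2`. [folklore] -/
theorem norm_one_sub_zPh_le (k e : Tor L) : ‖(1 : ℂ) - zPh L k e‖ ≤ 2 := by
  have hz : ‖zPh L k e‖ = 1 := by
    unfold zPh
    rw [Complex.norm_conj]
    have h := normSq_phase L k e
    rw [Complex.normSq_eq_norm_sq] at h
    nlinarith [norm_nonneg (phase L k e)]
  calc ‖(1 : ℂ) - zPh L k e‖ ≤ ‖(1 : ℂ)‖ + ‖zPh L k e‖ := norm_sub_le _ _
    _ = 2 := by rw [hz, norm_one]; norm_num

omit [NeZero L] in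
/-- `E(k) ≥ 0`. [folklore] -/
theorem EK_nonneg (k : Tor L) : 0 ≤ EK L k := by
  unfold EK; have := epsT_nonneg L k; linarith

/-- `|μ_e(k)| ≤ ‖1 − z‖β + q` when `β, q ≥ 0`. [folklore] -/
theorem norm_muK_le {Δ lam2 : ℝ} {f : Tor L → ℝ} (e k : Tor L) (hβ : 0 ≤ betaK L Δ lam2 f k) (hq : 0 ≤ qPar L Δ f) :
    ‖muK L Δ lam2 f e k‖ ≤ ‖(1 : ℂ) - zPh L k e‖ * betaK L Δ lam2 f k + qPar L Δ f := by
  unfold muK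
  have h2 := norm_one_add_zPh_le L k e
  calc ‖-(1 - zPh L k e) * ((betaK L Δ lam2 f k : ℝ) : ℂ) + ((qPar L Δ f / 2 : ℝ) : ℂ) * (1 + zPh L k e)‖
      ≤ ‖-(1 - zPh L k e) * ((betaK L Δ lam2 f k : ℝ) : ℂ)‖ + ‖((qPar L Δ f / 2 : ℝ) : ℂ) * (1 + zPh L k e)‖ :=
        norm_add_le _ _
    _ = ‖(1 : ℂ) - zPh L k e‖ * betaK L Δ lam2 f k + qPar L Δ f / 2 * ‖(1 : ℂ) + zPh L k e‖ := by
        rw [norm_mul, norm_mul, norm_neg, Complex.norm_real, Complex.norm_real, Real.norm_eq_abs,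
          Real.norm_eq_abs, abs_of_nonneg hβ, abs_of_nonneg (by linarith)]
    _ ≤ ‖(1 : ℂ) - zPh L k e‖ * betaK L Δ lam2 f k + qPar L Δ f / 2 * 2 := by gcongr
    _ = ‖(1 : ℂ) - zPh L k e‖ * betaK L Δ lam2 f k + qPar L Δ f := by ring

/-! ## Regime facts -/

/-- signs in the regime: `c_s, d, q, β(k), g(k), τ̄ ≥ 0`. [folklore] -/
theorem regime_signs (hL : 5 ≤ L) {Δ : ℝ} (hΔ0 : 0 ≤ Δ) (hΔ1 : Δ < 1) {lam2 : ℝ} {f : Tor L → ℝ}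
    (hf : IsGroundTwoMagnon L Δ lam2 f) (k : Tor L) :
    0 ≤ cS L Δ lam2 f ∧ 0 ≤ dPar L Δ f ∧ 0 ≤ qPar L Δ f ∧ 0 ≤ betaK L Δ lam2 f k ∧ 0 ≤ gres L lam2 k ∧
      0 ≤ tauBar L Δ lam2 f := by
  have hL2 : 2 ≤ L := by omega
  have h0 : 0 < lam2 := lam2_pos L (by omega) hΔ1 hf.1
  have h2l : 2 * lam2 < eps1 L := two_lam2_lt_eps1 L hL hΔ0 hf
  have hfpos : 0 < f (K1 L) := hf.1.2.2.1
  have hc : 0 ≤ cS L Δ lam2 f := by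
    unfold cS; apply mul_nonneg hfpos.le; nlinarith
  have hg : 0 ≤ gres L lam2 k := gres_nonneg_of_lt L hL2 (by linarith) k
  have hd : 0 ≤ dPar L Δ f := by unfold dPar; positivity
  have hq : 0 ≤ qPar L Δ f := by
    unfold qPar; apply mul_nonneg (mul_nonneg hΔ0 (sq_nonneg _)); linarith
  have hβ : 0 ≤ betaK L Δ lam2 f k := by unfold betaK; positivity
  have hτ : 0 ≤ tauBar L Δ lam2 f := by
    have hex : ex L ∈ nnList L := by unfold nnList ex; simp
    have h := gradSNormClosed_holds L (by omega) Δ lam2 f hf (ex L) hex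
    have : tauBar L Δ lam2 f = ∑ r : Tor L, Dgrad L (sfun' L Δ f) (ex L) r ^ 2 := by
      rw [h]; unfold tauBar sNormSq aPar; ring
    rw [this]; positivity
  exact ⟨hc, hd, hq, hβ, hg, hτ⟩

/-! ## The per-direction and per-momentum bounds -/

/-- per direction `e`: `||φ̂_e(k)|² − |μ_e(k)|²| ≤ ‖1−z_e‖²·A + B` with `A = βκ̂′g + β²τ̄/(2m₀) + κ̂′²g²/2`,
`B = m₀τ̄/2 + 2qκ̂′g + qτ̄ + τ̄²/2`. [folklore] -/
theorem dir_normSq_diff_le (hL : 5 ≤ L) {Δ : ℝ} (hΔ0 : 0 ≤ Δ) (hΔ1 : Δ < 1) {lam2 : ℝ} {f : Tor L → ℝ}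
    (hf : IsGroundTwoMagnon L Δ lam2 f) (M2 : ℕ) (hM : 4 * (M2 + 2) ≤ L) {m0 : ℝ} (hm0 : 0 < m0)
    (k : Tor L) (hk : k ≠ 0) (hfloor : 1 - Real.cos (2 * Real.pi * (M2 + 1) / L) ≤ epsT L k)
    (e : Tor L) (he : e ∈ nnList L) :
    |Complex.normSq (phiHat L f e k) - Complex.normSq (muK L Δ lam2 f e k)|
      ≤ Complex.normSq (1 - zPh L k e)
          * (betaK L Δ lam2 f k * ((kapHat L Δ lam2 f M2 + 2 * aPar L Δ f * cS L Δ lam2 f / (L : ℝ) ^ 2) * gres L lam2 k)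
            + betaK L Δ lam2 f k ^ 2 * tauBar L Δ lam2 f / (2 * m0)
            + ((kapHat L Δ lam2 f M2 + 2 * aPar L Δ f * cS L Δ lam2 f / (L : ℝ) ^ 2) * gres L lam2 k) ^ 2 / 2)
        + (m0 * tauBar L Δ lam2 f / 2
            + 2 * qPar L Δ f * ((kapHat L Δ lam2 f M2 + 2 * aPar L Δ f * cS L Δ lam2 f / (L : ℝ) ^ 2) * gres L lam2 k)
            + qPar L Δ f * tauBar L Δ lam2 f + tauBar L Δ lam2 f ^ 2 / 2) := by
  have h0 : 0 < lam2 := lam2_pos L (by omega) hΔ1 hf.1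
  obtain ⟨hc, hd, hq, hβ, hg, hτ⟩ := regime_signs L hL hΔ0 hΔ1 hf k
  set K := (kapHat L Δ lam2 f M2 + 2 * aPar L Δ f * cS L Δ lam2 f / (L : ℝ) ^ 2) * gres L lam2 k with hKdef
  have ht := tail_slope_abs L hL hΔ0 hΔ1 hf M2 hM k hk hfloor
  have hK0 : 0 ≤ K := (abs_nonneg _).trans ht
  set u := ‖(1 : ℂ) - zPh L k e‖ with hu
  have hu0 : 0 ≤ u := norm_nonneg _
  have hu2 : u ≤ 2 := norm_one_sub_zPh_le L k e
  -- `‖φ̂ − μ‖ ≤ uK/2 + τ̄/2`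
  have hnear := phiHatNearClosed_holds L hL hΔ0 lam2 f hf h0 e he k hk
  have hP : ‖phiHat L f e k - muK L Δ lam2 f e k‖ ≤ u * K / 2 + tauBar L Δ lam2 f / 2 := by
    refine hnear.trans ?_
    have : ‖(1 : ℂ) - zPh L k e‖ / 2 * |tfun L Δ f k| ≤ u / 2 * K := by
      rw [hu]; exact mul_le_mul_of_nonneg_left ht (by positivity)
    linarith
  -- block cross term, second part
  have hbc := (blockCrossTerm_holds (phiHat L f e k) 0 (muK L Δ lam2 f e k) 0 (u * K / 2 + tauBar L Δ lam2 f / 2) 0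
    hP (by simp)).2
  have hμ := norm_muK_le L e k hβ hq
  have hpoly := dir_poly_bound (β := betaK L Δ lam2 f k) hu2 hq hK0 hτ hm0
  have hPnn : 0 ≤ u * K / 2 + tauBar L Δ lam2 f / 2 := by positivity
  have hstep : 2 * ‖muK L Δ lam2 f e k‖ * (u * K / 2 + tauBar L Δ lam2 f / 2)
      ≤ 2 * (u * betaK L Δ lam2 f k + qPar L Δ f) * (u * K / 2 + tauBar L Δ lam2 f / 2) := by
    have : ‖muK L Δ lam2 f e k‖ ≤ u * betaK L Δ lam2 f k + qPar L Δ f := by rw [hu]; linarith [hμ]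
    nlinarith
  have hnsq : Complex.normSq (1 - zPh L k e) = u ^ 2 := by
    rw [hu, Complex.normSq_eq_norm_sq]
  rw [hnsq]
  linarith [hbc, hstep, hpoly]

/-- `|Σ_e |φ̂_e(k)|² − M(k)| ≤ Y + P₂` (as `2E·A + 4B`). [folklore] -/
theorem sum_normSq_diff_le (hL : 5 ≤ L) {Δ : ℝ} (hΔ0 : 0 ≤ Δ) (hΔ1 : Δ < 1) {lam2 : ℝ} {f : Tor L → ℝ}
    (hf : IsGroundTwoMagnon L Δ lam2 f) (M2 : ℕ) (hM : 4 * (M2 + 2) ≤ L) {m0 : ℝ} (hm0 : 0 < m0)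
    (k : Tor L) (hk : k ≠ 0) (hfloor : 1 - Real.cos (2 * Real.pi * (M2 + 1) / L) ≤ epsT L k) :
    let K := (kapHat L Δ lam2 f M2 + 2 * aPar L Δ f * cS L Δ lam2 f / (L : ℝ) ^ 2) * gres L lam2 k
    |Complex.normSq (phiHat L f (ex L) k) + Complex.normSq (phiHat L f (-ex L) k)
        + Complex.normSq (phiHat L f (ey L) k) + Complex.normSq (phiHat L f (-ey L) k) - MK L Δ lam2 f k|
      ≤ 2 * EK L k * (betaK L Δ lam2 f k * K + betaK L Δ lam2 f k ^ 2 * tauBar L Δ lam2 f / (2 * m0) + K ^ 2 / 2)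
        + 4 * (m0 * tauBar L Δ lam2 f / 2 + 2 * qPar L Δ f * K + qPar L Δ f * tauBar L Δ lam2 f
          + tauBar L Δ lam2 f ^ 2 / 2) := by
  dsimp only
  set K := (kapHat L Δ lam2 f M2 + 2 * aPar L Δ f * cS L Δ lam2 f / (L : ℝ) ^ 2) * gres L lam2 k with hKdef
  have hMK := mKIdentity_holds L Δ lam2 f k
  have hE := phaseDefectSum_holds L k
  rw [nnList_map_sum] at hE hMK
  have hm1 : ex L ∈ nnList L := by unfold nnList ex; simp
  have hm2 : -ex L ∈ nnList L := by rw [← neg_ex]; unfold nnList; simp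
  have hm3 : ey L ∈ nnList L := by unfold nnList ey; simp
  have hm4 : -ey L ∈ nnList L := by rw [← neg_ey]; unfold nnList; simp
  have d1 := dir_normSq_diff_le L hL hΔ0 hΔ1 hf M2 hM hm0 k hk hfloor (ex L) hm1
  have d2 := dir_normSq_diff_le L hL hΔ0 hΔ1 hf M2 hM hm0 k hk hfloor (-ex L) hm2
  have d3 := dir_normSq_diff_le L hL hΔ0 hΔ1 hf M2 hM hm0 k hk hfloor (ey L) hm3
  have d4 := dir_normSq_diff_le L hL hΔ0 hΔ1 hf M2 hM hm0 k hk hfloor (-ey L) hm4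
  rw [← hKdef] at d1 d2 d3 d4
  rw [← hMK]
  have e : Complex.normSq (phiHat L f (ex L) k) + Complex.normSq (phiHat L f (-ex L) k)
        + Complex.normSq (phiHat L f (ey L) k) + Complex.normSq (phiHat L f (-ey L) k)
      - (Complex.normSq (muK L Δ lam2 f (ex L) k) + Complex.normSq (muK L Δ lam2 f (-ex L) k)
        + Complex.normSq (muK L Δ lam2 f (ey L) k) + Complex.normSq (muK L Δ lam2 f (-ey L) k))
      = (Complex.normSq (phiHat L f (ex L) k) - Complex.normSq (muK L Δ lam2 f (ex L) k))
        + (Complex.normSq (phiHat L f (-ex L) k) - Complex.normSq (muK L Δ lam2 f (-ex L) k))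
        + (Complex.normSq (phiHat L f (ey L) k) - Complex.normSq (muK L Δ lam2 f (ey L) k))
        + (Complex.normSq (phiHat L f (-ey L) k) - Complex.normSq (muK L Δ lam2 f (-ey L) k)) := by ring
  rw [e]
  obtain ⟨l1, r1⟩ := abs_le.1 d1
  obtain ⟨l2, r2⟩ := abs_le.1 d2
  obtain ⟨l3, r3⟩ := abs_le.1 d3
  obtain ⟨l4, r4⟩ := abs_le.1 d4
  rw [← hE, add_mul, add_mul, add_mul]
  exact abs_le.2 ⟨by linarith, by linarith⟩

/-- ★ per momentum off the block: `|Σ_e |φ̂_e|²F₂ − M c| ≤ Mκ̂′g + (Y + P₂)(|c| + κ̂′g)` (notation of `PC0OuterBound`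
with `κ̂′ = kapHat + 2·aPar·cS/V`). [folklore] -/
theorem pc0_term_bound (hL : 5 ≤ L) {Δ : ℝ} (hΔ0 : 0 ≤ Δ) (hΔ1 : Δ < 1) {lam2 : ℝ} {f : Tor L → ℝ}
    (hf : IsGroundTwoMagnon L Δ lam2 f) (M2 : ℕ) (hM : 4 * (M2 + 2) ≤ L) {m0 : ℝ} (hm0 : 0 < m0)
    (k : Tor L) (hk : k ≠ 0) (hfloor : 1 - Real.cos (2 * Real.pi * (M2 + 1) / L) ≤ epsT L k) :
    let g := gres L lam2
    let ac : Tor L → ℝ := fun k => 2 * cS L Δ lam2 f * g k + dPar L Δ f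
    let κ := kapHat L Δ lam2 f M2 + 2 * aPar L Δ f * cS L Δ lam2 f / (L : ℝ) ^ 2
    let τ := tauBar L Δ lam2 f
    let q := qPar L Δ f
    let β := betaK L Δ lam2 f
    let Y : Tor L → ℝ := fun k =>
      2 * β k * κ * g k * EK L k + τ * (β k ^ 2 * EK L k / m0 + 2 * m0) + 8 * q * κ * g k + 4 * q * τ
    let P2 : Tor L → ℝ := fun k => EK L k * κ ^ 2 * g k ^ 2 + 2 * τ ^ 2
    |((nnList L).map (fun e => Complex.normSq (phiHat L f e k))).sum * F2 L f k - MK L Δ lam2 f k * cK L Δ lam2 f k|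
      ≤ MK L Δ lam2 f k * κ * g k + (Y k + P2 k) * (ac k + κ * g k) := by
  dsimp only
  have h0 : 0 < lam2 := lam2_pos L (by omega) hΔ1 hf.1
  obtain ⟨hc, hd, hq, hβ, hg, hτ⟩ := regime_signs L hL hΔ0 hΔ1 hf k
  set K := (kapHat L Δ lam2 f M2 + 2 * aPar L Δ f * cS L Δ lam2 f / (L : ℝ) ^ 2) * gres L lam2 k with hKdef
  have ht := tail_slope_abs L hL hΔ0 hΔ1 hf M2 hM k hk hfloor
  have hK0 : 0 ≤ K := (abs_nonneg _).trans ht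
  have hF2 := (f2ClosedPlusTail_holds L hL hΔ0 lam2 f hf h0).2 k hk
  have hMK := mKIdentity_holds L Δ lam2 f k
  have hMnn : 0 ≤ MK L Δ lam2 f k := by
    rw [← hMK, nnList_map_sum]
    exact add_nonneg (add_nonneg (add_nonneg (Complex.normSq_nonneg _) (Complex.normSq_nonneg _))
      (Complex.normSq_nonneg _)) (Complex.normSq_nonneg _)
  have hE := phaseDefectSum_holds L k
  rw [nnList_map_sum] at hE hMK
  have hSM' := sum_normSq_diff_le L hL hΔ0 hΔ1 hf M2 hM hm0 k hk hfloor
  dsimp only at hSM'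
  rw [← hKdef] at hSM'
  rw [nnList_map_sum]
  set S := Complex.normSq (phiHat L f (ex L) k) + Complex.normSq (phiHat L f (-ex L) k)
    + Complex.normSq (phiHat L f (ey L) k) + Complex.normSq (phiHat L f (-ey L) k) with hS
  have hSM : |S - MK L Δ lam2 f k|
      ≤ 2 * EK L k * (betaK L Δ lam2 f k * K + betaK L Δ lam2 f k ^ 2 * tauBar L Δ lam2 f / (2 * m0) + K ^ 2 / 2)
        + 4 * (m0 * tauBar L Δ lam2 f / 2 + 2 * qPar L Δ f * K + qPar L Δ f * tauBar L Δ lam2 f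
          + tauBar L Δ lam2 f ^ 2 / 2) := hSM'
  -- assemble: `S F₂ − M c = (S − M)(c + t) + M t`
  have hc_abs := abs_cK_eq L hL hΔ0 hΔ1 hf k
  have e2 : S * F2 L f k - MK L Δ lam2 f k * cK L Δ lam2 f k
      = (S - MK L Δ lam2 f k) * (cK L Δ lam2 f k + tfun L Δ f k) + MK L Δ lam2 f k * tfun L Δ f k := by
    rw [hF2]; ring
  rw [e2]
  have hct : |cK L Δ lam2 f k + tfun L Δ f k| ≤ (2 * cS L Δ lam2 f * gres L lam2 k + dPar L Δ f) + K := by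
    refine (abs_add_le _ _).trans ?_
    rw [hc_abs]; linarith
  have hYP : 0 ≤ 2 * EK L k * (betaK L Δ lam2 f k * K + betaK L Δ lam2 f k ^ 2 * tauBar L Δ lam2 f / (2 * m0) + K ^ 2 / 2)
        + 4 * (m0 * tauBar L Δ lam2 f / 2 + 2 * qPar L Δ f * K + qPar L Δ f * tauBar L Δ lam2 f
          + tauBar L Δ lam2 f ^ 2 / 2) := by
    have hE0 : 0 ≤ EK L k := EK_nonneg L k
    positivity
  calc |(S - MK L Δ lam2 f k) * (cK L Δ lam2 f k + tfun L Δ f k) + MK L Δ lam2 f k * tfun L Δ f k|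
      ≤ |(S - MK L Δ lam2 f k) * (cK L Δ lam2 f k + tfun L Δ f k)| + |MK L Δ lam2 f k * tfun L Δ f k| :=
        abs_add_le _ _
    _ = |S - MK L Δ lam2 f k| * |cK L Δ lam2 f k + tfun L Δ f k| + MK L Δ lam2 f k * |tfun L Δ f k| := by
        rw [abs_mul, abs_mul, abs_of_nonneg hMnn]
    _ ≤ (2 * EK L k * (betaK L Δ lam2 f k * K + betaK L Δ lam2 f k ^ 2 * tauBar L Δ lam2 f / (2 * m0) + K ^ 2 / 2)
          + 4 * (m0 * tauBar L Δ lam2 f / 2 + 2 * qPar L Δ f * K + qPar L Δ f * tauBar L Δ lam2 f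
            + tauBar L Δ lam2 f ^ 2 / 2))
          * ((2 * cS L Δ lam2 f * gres L lam2 k + dPar L Δ f) + K) + MK L Δ lam2 f k * K := by
        exact add_le_add (mul_le_mul hSM hct (abs_nonneg _) hYP) (mul_le_mul_of_nonneg_left ht hMnn)
    _ = _ := by
        rw [hKdef]; field_simp; ring

/-- ★ `⟨Π⁰,C0⟩` OUTER MAJORANT (repaired slope): the sum over `outer1` of `pc0_term_bound` — `PC0OuterBound` with `κ̂′` for `κ̂`,
conditional on nothing but the regime (`L ≥ 5`, `0 ≤ Δ < 1`, ground state, `4(M₂+2) ≤ L`, `m₀ > 0`). [folklore] -/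
theorem pc0_outer_bound (hL : 5 ≤ L) {Δ : ℝ} (hΔ0 : 0 ≤ Δ) (hΔ1 : Δ < 1) {lam2 : ℝ} {f : Tor L → ℝ}
    (hf : IsGroundTwoMagnon L Δ lam2 f) (M2 : ℕ) (hM : 4 * (M2 + 2) ≤ L) {m0 : ℝ} (hm0 : 0 < m0) :
    let g := gres L lam2
    let ac : Tor L → ℝ := fun k => 2 * cS L Δ lam2 f * g k + dPar L Δ f
    let κ := kapHat L Δ lam2 f M2 + 2 * aPar L Δ f * cS L Δ lam2 f / (L : ℝ) ^ 2
    let τ := tauBar L Δ lam2 f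
    let q := qPar L Δ f
    let β := betaK L Δ lam2 f
    let Y : Tor L → ℝ := fun k =>
      2 * β k * κ * g k * EK L k + τ * (β k ^ 2 * EK L k / m0 + 2 * m0) + 8 * q * κ * g k + 4 * q * τ
    let P2 : Tor L → ℝ := fun k => EK L k * κ ^ 2 * g k ^ 2 + 2 * τ ^ 2
    |∑ k ∈ outer1 L M2,
        (((nnList L).map (fun e => Complex.normSq (phiHat L f e k))).sum * F2 L f k - MK L Δ lam2 f k * cK L Δ lam2 f k)|
      ≤ ∑ k ∈ outer1 L M2, (MK L Δ lam2 f k * κ * g k + (Y k + P2 k) * (ac k + κ * g k)) := by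
  dsimp only
  have hfl := ((outerEnergyFloor_holds L M2) hM).2
  refine (Finset.abs_sum_le_sum_abs _ _).trans (Finset.sum_le_sum fun k hk => ?_)
  have hk0 : k ≠ 0 := by
    unfold outer1 at hk
    exact (Finset.mem_erase.1 (Finset.mem_filter.1 hk).1).1
  exact pc0_term_bound L hL hΔ0 hΔ1 hf M2 hM hm0 k hk0 (hfl k hk)

end OuterMaj

end Summit.HubbardSuperconductivity.HubbardSuperconductivity.Theorems.AnisotropyChord.Transfer.Fibre3

end
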